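import Summits.Ventures.Crystal3D.Theorems.StickyWulffConstantNoReconstructionGainGrainFrameLocalAbove
import Summits.Ventures.Crystal3D.Theorems.StickyWulffConstantNoReconstructionGainGrainFilmSlab
import HarnessLib

/-!
# Multi-frame films gain nothing: misoriented Barlow-type grains in the basal cone, at every normal

HONEST FRAMING. Part of the venture `Summits/Ventures/Crystal3D` (cell `crystal3d-full`), helper
`--supports` the crux `NoReconstructionGain` (stmt-Ventures-19144, route
`route-Ventures-StickyWulffConstant`), line `adhesion` (wulff-p1 g12).  Class (iii) of the line's
census extended from films inside ONE moved fcc lattice (`grainFilm_slab`, `…GrainFilmSlab`) to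
MULTI-FRAME films: every film ball `q` carries its own moved fcc bond star `A_q U₀`, and every film
contact of `q` is either registered in `q`'s star or interstitial there and strictly above `q`.

Why this is the right generality: the frame account `perBall_frameAccount_eq` (`…CapFrameLocal`) is a
PER-BALL identity, so the frame may depend on the ball; the only coupling between balls is the
antisymmetric TRANSFER term, and `frameTransfer_eq_sign` shows that under the registered-or-
interstitial-above hypothesis the transfer along a film contact is the frame-independent sign of the
height difference — so the transfers still cancel over the film.  Example: a misoriented grain of an
ARBITRARY Barlow stacking (hcp, dhcp, twinned fcc, …) whose basal plane is tilted by less than `54.7°`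
from the cut — give each ball the moved fcc star containing its six in-plane and three DOWN bonds; its
three up bonds are interstitial (`33.6°` off the star) and strictly above.

* `frameTransfer_eq_sign` — the transfer term of the frame account along a registered-or-
  interstitial-above contact equals `[x below q] − [x above q]`.
* `multiFrameFilm_cross_le` — **film-level bound**: `X` a finite unit packing, `P ⊆ X` below the cut,
  film above the cut, each film ball `q` with a twelve-direction frame `U_q` (unit, `−U_q = U_q`,
  pairwise `≥ 60°`) satisfying the cap budget, at most three substrate contacts, and every film contact
  registered-or-interstitial-above in `U_q`: then `#cross(P, X∖P) ≤ D(X∖P)` — no error term.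
* `multiFrameGrainFilm_slab` — **rung** (constants `R = 1`, `C = 0`): the same for the fcc slab
  sample, frames `U_q = A_q U₀` for any assignment `q ↦ A_q` of isometries, film balls off `Λ₀`, via the
  landed cap budget `stub_frameCapBudget`.

WHAT THIS IS NOT: the crux — amorphous / polycrystalline films whose balls admit no such frame are
untouched, as are Barlow-type grains tilted beyond the basal cone (there the up bonds of one layer type
are not above: the per-ball account fails by one and only a bilayer pairing could restore it) and
on-lattice coincidence balls; rung F-C1 not moved.
-/

noncomputable section

namespace Summit.Ventures.Crystal3D.Theorems

open Summit.Ventures.Crystal3D Finset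
open Literature.MathematicalPhysics.StatisticalMechanics (fccStacking orderedContacts contactDeficiency)
open scoped InnerProductSpace

/-- **The transfer along a registered-or-interstitial-above contact is the sign of the height
difference.**  `W` a frame (closed under negation, pairwise `⟪d, d'⟫ ≤ 1/2`), `x` a
contact of `q` (`‖x − q‖ = 1`) with `x − q ∈ W` or `x − q` interstitial (`⟪x − q, d⟫ ≤ √3/2` on `W`)
and `x` strictly above `q`. -/
theorem frameTransfer_eq_sign (W : Finset (EuclideanSpace ℝ (Fin 3)))
    (hWsep : ∀ d ∈ W, ∀ d' ∈ W, d ≠ d' → ⟪d, d'⟫_ℝ ≤ 1 / 2)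
    (hWneg : ∀ d ∈ W, -d ∈ W) (ν q x : EuclideanSpace ℝ (Fin 3)) (hqx : dist q x = 1)
    (H : x - q ∈ W ∨ ((∀ d ∈ W, ⟪x - q, d⟫_ℝ ≤ Real.sqrt 3 / 2) ∧ ⟪q, ν⟫_ℝ < ⟪x, ν⟫_ℝ)) :
    ((if ∃ d ∈ W, ⟪d, ν⟫_ℝ < 0 ∧ Real.sqrt 3 / 2 < ⟪x - q, d⟫_ℝ then (1 : ℤ) else 0)
        + (if (∀ d ∈ W, ⟪x - q, d⟫_ℝ ≤ Real.sqrt 3 / 2) ∧ ⟪x, ν⟫_ℝ < ⟪q, ν⟫_ℝ then (1 : ℤ) else 0))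
      - ((if ∃ d ∈ W, ⟪d, ν⟫_ℝ < 0 ∧ Real.sqrt 3 / 2 < ⟪q - x, d⟫_ℝ then (1 : ℤ) else 0)
        + (if (∀ d ∈ W, ⟪q - x, d⟫_ℝ ≤ Real.sqrt 3 / 2) ∧ ⟪q, ν⟫_ℝ < ⟪x, ν⟫_ℝ then (1 : ℤ) else 0))
    = (if ⟪x, ν⟫_ℝ < ⟪q, ν⟫_ℝ then (1 : ℤ) else 0) - (if ⟪q, ν⟫_ℝ < ⟪x, ν⟫_ℝ then (1 : ℤ) else 0) := by
  classical
  obtain ⟨hc0, hc1, -⟩ := sqrt_three_div_two_bounds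
  have hhalf : (1 : ℝ) / 2 < Real.sqrt 3 / 2 := by
    rw [div_lt_div_iff_of_pos_right (by norm_num : (0:ℝ) < 2)]
    have := Real.lt_sqrt (by norm_num : (0:ℝ) ≤ 1) |>.2 (by norm_num : (1:ℝ) ^ 2 < 3)
    linarith
  have hu : ‖x - q‖ = 1 := by rw [← dist_eq_norm, dist_comm, hqx]
  have hself : ⟪x - q, x - q⟫_ℝ = 1 := by rw [real_inner_self_eq_norm_sq, hu, one_pow]
  have hqxe : q - x = -(x - q) := by abel
  rcases H with hW | ⟨hint, habv⟩
  · -- registered: the only cap containing `x − q` is its own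
    have huniq : ∀ d ∈ W, Real.sqrt 3 / 2 < ⟪x - q, d⟫_ℝ → d = x - q := by
      intro d hd hlt
      by_contra hne
      have := hWsep (x - q) hW d hd (Ne.symm hne)
      linarith
    have hnW : -(x - q) ∈ W := hWneg _ hW
    have huniq' : ∀ d ∈ W, Real.sqrt 3 / 2 < ⟪q - x, d⟫_ℝ → d = q - x := by
      intro d hd hlt
      rw [hqxe] at hlt ⊢
      by_contra hne
      have := hWsep (-(x - q)) hnW d hd (Ne.symm hne)
      linarith
    have e1 : (∃ d ∈ W, ⟪d, ν⟫_ℝ < 0 ∧ Real.sqrt 3 / 2 < ⟪x - q, d⟫_ℝ) ↔ ⟪x, ν⟫_ℝ < ⟪q, ν⟫_ℝ := by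
      constructor
      · rintro ⟨d, hd, hdn, hlt⟩
        rw [huniq d hd hlt, inner_sub_left] at hdn
        linarith
      · intro h
        exact ⟨x - q, hW, by rw [inner_sub_left]; linarith, by rw [hself]; exact hc1⟩
    have e2 : ¬ ((∀ d ∈ W, ⟪x - q, d⟫_ℝ ≤ Real.sqrt 3 / 2) ∧ ⟪x, ν⟫_ℝ < ⟪q, ν⟫_ℝ) := by
      rintro ⟨h, -⟩
      have := h (x - q) hW
      rw [hself] at this
      linarith
    have e3 : (∃ d ∈ W, ⟪d, ν⟫_ℝ < 0 ∧ Real.sqrt 3 / 2 < ⟪q - x, d⟫_ℝ) ↔ ⟪q, ν⟫_ℝ < ⟪x, ν⟫_ℝ := by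
      constructor
      · rintro ⟨d, hd, hdn, hlt⟩
        rw [huniq' d hd hlt, inner_sub_left] at hdn
        linarith
      · intro h
        refine ⟨q - x, by rw [hqxe]; exact hnW, by rw [inner_sub_left]; linarith, ?_⟩
        rw [hqxe, inner_neg_left, inner_neg_right, neg_neg, hself]; exact hc1
    have e4 : ¬ ((∀ d ∈ W, ⟪q - x, d⟫_ℝ ≤ Real.sqrt 3 / 2) ∧ ⟪q, ν⟫_ℝ < ⟪x, ν⟫_ℝ) := by
      rintro ⟨h, -⟩
      have := h (q - x) (by rw [hqxe]; exact hnW)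
      rw [hqxe, inner_neg_left, inner_neg_right, neg_neg, hself] at this
      linarith
    rw [if_neg e2, if_neg e4]
    by_cases h1 : ⟪x, ν⟫_ℝ < ⟪q, ν⟫_ℝ
    · rw [if_pos (e1.2 h1), if_pos h1, if_neg (e3.not.2 (not_lt.2 h1.le)), if_neg (not_lt.2 h1.le)]
      norm_num
    · rw [if_neg (e1.not.2 h1), if_neg h1]
      by_cases h2 : ⟪q, ν⟫_ℝ < ⟪x, ν⟫_ℝ
      · rw [if_pos (e3.2 h2), if_pos h2]
        norm_num
      · rw [if_neg (e3.not.2 h2), if_neg h2]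
        norm_num
  · -- interstitial and strictly above
    have hint' : ∀ d ∈ W, ⟪q - x, d⟫_ℝ ≤ Real.sqrt 3 / 2 := by
      intro d hd
      have := hint (-d) (hWneg d hd)
      rw [inner_neg_right] at this
      rw [hqxe, inner_neg_left]; exact this
    have e1 : ¬ (∃ d ∈ W, ⟪d, ν⟫_ℝ < 0 ∧ Real.sqrt 3 / 2 < ⟪x - q, d⟫_ℝ) := by
      rintro ⟨d, hd, -, hlt⟩; exact absurd (hint d hd) (not_le.2 hlt)
    have e3 : ¬ (∃ d ∈ W, ⟪d, ν⟫_ℝ < 0 ∧ Real.sqrt 3 / 2 < ⟪q - x, d⟫_ℝ) := by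
      rintro ⟨d, hd, -, hlt⟩; exact absurd (hint' d hd) (not_le.2 hlt)
    have hnlt : ¬ ⟪x, ν⟫_ℝ < ⟪q, ν⟫_ℝ := not_lt.2 habv.le
    rw [if_neg e1, if_neg e3, if_neg (fun h => hnlt h.2), if_pos ⟨hint', habv⟩, if_neg hnlt, if_pos habv]
    norm_num

set_option maxHeartbeats 800000 in
/-- **Multi-frame films gain nothing** (film-level bound).  See the module docstring. -/
theorem multiFrameFilm_cross_le (X P : Finset (EuclideanSpace ℝ (Fin 3)))
    (hX : ∀ p ∈ X, ∀ q ∈ X, p ≠ q → 1 ≤ dist p q) (hPX : P ⊆ X)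
    (Uf : EuclideanSpace ℝ (Fin 3) → Finset (EuclideanSpace ℝ (Fin 3)))
    (hU1 : ∀ q ∈ X \ P, ∀ d ∈ Uf q, ‖d‖ = 1)
    (hUsep : ∀ q ∈ X \ P, ∀ d ∈ Uf q, ∀ d' ∈ Uf q, d ≠ d' → ⟪d, d'⟫_ℝ ≤ 1 / 2)
    (hUneg : ∀ q ∈ X \ P, ∀ d ∈ Uf q, -d ∈ Uf q) (hUcard : ∀ q ∈ X \ P, (Uf q).card = 12)
    (hcap : ∀ q ∈ X \ P, ∀ ν : EuclideanSpace ℝ (Fin 3), ‖ν‖ = 1 → ∀ t : ℝ, 0 < t →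
      ∀ K : Finset (EuclideanSpace ℝ (Fin 3)), K.card ≤ 3 →
      (∀ u ∈ K, ‖u‖ = 1 ∧ ⟪u, ν⟫_ℝ ≤ -t) → (∀ u ∈ K, ∀ u' ∈ K, u ≠ u' → ⟪u, u'⟫_ℝ ≤ 1 / 2) →
      (K.card : ℝ) ≤
        (((Uf q).filter fun d => ⟪d, ν⟫_ℝ < 0 ∧ ((∃ u ∈ K, 1 / 2 < ⟪u, d⟫_ℝ) ∨ ⟪d, ν⟫_ℝ ≤ -t)).card : ℝ)
          + (1 / 2) * (((Uf q).filter fun d => ⟪d, ν⟫_ℝ = 0 ∧ ∃ u ∈ K, 1 / 2 < ⟪u, d⟫_ℝ).card : ℝ))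
    (ν : EuclideanSpace ℝ (Fin 3)) (hν : ‖ν‖ = 1) (R : ℝ)
    (hbelow : ∀ p ∈ P, ⟪p, ν⟫_ℝ ≤ -R) (habove : ∀ x ∈ X \ P, -R < ⟪x, ν⟫_ℝ)
    (h3 : ∀ q ∈ X \ P, (P.filter fun p => dist q p = 1).card ≤ 3)
    (hreg : ∀ q ∈ X \ P, ∀ x ∈ X \ P, dist q x = 1 → x - q ∈ Uf q ∨
      ((∀ d ∈ Uf q, ⟪x - q, d⟫_ℝ ≤ Real.sqrt 3 / 2) ∧ ⟪q, ν⟫_ℝ < ⟪x, ν⟫_ℝ)) :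
    ((((P ×ˢ (X \ P)).filter fun pq => dist pq.1 pq.2 = 1).card : ℕ) : ℝ) ≤
      contactDeficiency (X \ P) := by
  classical
  set c : ℝ := Real.sqrt 3 / 2 with hc
  have hUsep' : ∀ q ∈ X \ P, ∀ d ∈ Uf q, ∀ d' ∈ Uf q, d ≠ d' → ⟪d, d'⟫_ℝ ≤ 2 * c ^ 2 - 1 := by
    intro q hq d hd d' hd' hne
    rw [hc, two_mul_sqrt_three_div_two_sq_sub_one]; exact hUsep q hq d hd d' hd' hne
  set cP : EuclideanSpace ℝ (Fin 3) → ℝ := fun q => ((P.filter fun p => dist q p = 1).card : ℝ) with hcP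
  set dF : EuclideanSpace ℝ (Fin 3) → ℝ := fun q =>
    (((X \ P).filter fun x => dist q x = 1).card : ℝ) with hdF
  -- the frame-independent transfer
  set T : EuclideanSpace ℝ (Fin 3) → EuclideanSpace ℝ (Fin 3) → ℤ := fun x y =>
    (if ⟪x, ν⟫_ℝ < ⟪y, ν⟫_ℝ then (1 : ℤ) else 0) - (if ⟪y, ν⟫_ℝ < ⟪x, ν⟫_ℝ then (1 : ℤ) else 0) with hT
  have hT_anti : ∀ x y, T x y = -T y x := fun x y => by simp only [hT]; ring
  set S : EuclideanSpace ℝ (Fin 3) → ℝ := fun q =>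
    ((∑ x ∈ (X \ P).filter (fun x => dist q x = 1), T x q : ℤ) : ℝ) with hS
  -- per ball: account identity + per-ball bound + transfer rewrite give `2 cP + dF + S ≤ 12`
  have hkey : ∀ q ∈ X \ P, 2 * cP q + dF q + S q ≤ 12 := by
    intro q hq
    have hK := perBall_frameAccount_eq X P hX hPX (Uf q) c le_rfl (hU1 q hq) (hUsep' q hq) (hUneg q hq) ν q hq
    have hle := perBall_frameFilm_le_of_above X P hX hPX (Uf q) (hU1 q hq) (hUsep q hq) (hcap q hq) ν hν R
      hbelow habove q hq (h3 q hq) (hreg q hq)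
    have htr : (∑ x ∈ (X \ P).filter (fun x => dist q x = 1),
        (((if ∃ d ∈ Uf q, ⟪d, ν⟫_ℝ < 0 ∧ c < ⟪x - q, d⟫_ℝ then (1 : ℤ) else 0)
          + (if (∀ d ∈ Uf q, ⟪x - q, d⟫_ℝ ≤ c) ∧ ⟪x, ν⟫_ℝ < ⟪q, ν⟫_ℝ then (1 : ℤ) else 0))
          - ((if ∃ d ∈ Uf q, ⟪d, ν⟫_ℝ < 0 ∧ c < ⟪q - x, d⟫_ℝ then (1 : ℤ) else 0)
          + (if (∀ d ∈ Uf q, ⟪q - x, d⟫_ℝ ≤ c) ∧ ⟪q, ν⟫_ℝ < ⟪x, ν⟫_ℝ then (1 : ℤ) else 0)))) =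
        ∑ x ∈ (X \ P).filter (fun x => dist q x = 1), T x q := by
      refine sum_congr rfl fun x hx => ?_
      have hxF : x ∈ X \ P := (mem_filter.1 hx).1
      have hqx : dist q x = 1 := (mem_filter.1 hx).2
      simp only [hT]
      exact frameTransfer_eq_sign (Uf q) (hUsep q hq) (hUneg q hq) ν q x hqx (hreg q hq x hxF hqx)
    rw [htr, hUcard q hq] at hK
    have hK' := congrArg (fun z : ℤ => (z : ℝ)) hK
    simp only [hcP, hdF, hS]
    push_cast at hK' ⊢
    linarith [hle, hK']
  -- sum over the film
  have hs0 : ∑ q ∈ X \ P, S q = 0 := by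
    simp only [hS]
    rw [← Int.cast_sum, sum_sum_transfer_eq_zero (X \ P) T hT_anti, Int.cast_zero]
  have hcross : ((((P ×ˢ (X \ P)).filter fun pq => dist pq.1 pq.2 = 1).card : ℕ) : ℝ) =
      ∑ q ∈ X \ P, cP q := card_cross_eq_sum_card_plug_partners P (X \ P)
  have hord : (orderedContacts (X \ P) : ℝ) = ∑ q ∈ X \ P, dF q :=
    orderedContacts_eq_sum_card_partners (X \ P)
  have hdef : contactDeficiency (X \ P) =
      6 * ((X \ P).card : ℝ) - (orderedContacts (X \ P) : ℝ) / 2 := rfl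
  have hsum : ∑ q ∈ X \ P, (2 * cP q + dF q + S q) ≤ ∑ q ∈ X \ P, (12 : ℝ) := sum_le_sum hkey
  simp only [sum_add_distrib, sum_const, nsmul_eq_mul, ← mul_sum] at hsum
  rw [hs0] at hsum
  rw [hcross, hdef, hord]
  linarith

/-- **RUNG: multi-frame grain films gain nothing, at every normal** (`R = 1`, `C = 0`).  For every
twelve-direction bond star `U₀` of `Λ₀` and every assignment `q ↦ A_q` of isometries: a finite unit
packing `X ⊇ P` containing the fcc slab sample `P`, whose film balls `q ∈ X ∖ P` lie above the cut,
off `Λ₀`, and whose film contacts `x` of `q` satisfy `A_q⁻¹(x − q) ∈ Λ₀` (registered in `q`'s frame)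
or `⟪A_q⁻¹(x − q), d⟫ ≤ √3/2` for all `d ∈ U₀` together with `⟪q, ν⟫ < ⟪x, ν⟫`
(interstitial-above), has `#cross(P, X∖P) ≤ D(X∖P) + C ρ`.  Covers misoriented fcc grains (one
frame) and misoriented grains of any Barlow stacking with basal tilt `< 54.7°` (two frames). -/
theorem multiFrameGrainFilm_slab :
    ∃ R C : ℝ, 1 ≤ R ∧ ∀ U₀ : Finset (EuclideanSpace ℝ (Fin 3)),
      (∀ d ∈ U₀, d ∈ fccStacking 1 (Real.sqrt (2 / 3)) ∧ ‖d‖ = 1) → (∀ d ∈ U₀, -d ∈ U₀) → U₀.card = 12 →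
      ∀ Af : EuclideanSpace ℝ (Fin 3) → (EuclideanSpace ℝ (Fin 3) ≃ₗᵢ[ℝ] EuclideanSpace ℝ (Fin 3)),
      ∀ ν : EuclideanSpace ℝ (Fin 3), ‖ν‖ = 1 → ∀ ρ : ℝ, R ≤ ρ →
      ∀ X P : Finset (EuclideanSpace ℝ (Fin 3)),
      (∀ p ∈ X, ∀ q ∈ X, p ≠ q → 1 ≤ dist p q) → P ⊆ X →
      (∀ p, p ∈ P ↔ (p ∈ fccStacking 1 (Real.sqrt (2 / 3)) ∧ -(2 * R) ≤ ⟪p, ν⟫_ℝ ∧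
        ⟪p, ν⟫_ℝ ≤ -R ∧ ‖p‖ ^ 2 - ⟪p, ν⟫_ℝ ^ 2 ≤ ρ ^ 2)) →
      (∀ q ∈ X \ P, -R < ⟪q, ν⟫_ℝ) →
      (∀ q ∈ X \ P, q ∉ fccStacking 1 (Real.sqrt (2 / 3))) →
      (∀ q ∈ X \ P, ∀ x ∈ X \ P, dist q x = 1 →
        (Af q).symm (x - q) ∈ fccStacking 1 (Real.sqrt (2 / 3)) ∨
        ((∀ d ∈ U₀, ⟪(Af q).symm (x - q), d⟫_ℝ ≤ Real.sqrt 3 / 2) ∧ ⟪q, ν⟫_ℝ < ⟪x, ν⟫_ℝ)) →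
      ((((P ×ˢ (X \ P)).filter fun pq => dist pq.1 pq.2 = 1).card : ℕ) : ℝ) ≤
        contactDeficiency (X \ P) + C * ρ := by
  classical
  refine ⟨1, 0, le_rfl, ?_⟩
  intro U₀ hU₀ hU₀neg hU₀card Af ν hν ρ hρ X P hX hPX hP habove hoff hreg
  rw [zero_mul, add_zero]
  set Uf : EuclideanSpace ℝ (Fin 3) → Finset (EuclideanSpace ℝ (Fin 3)) := fun q => U₀.image fun d => Af q d
    with hUf
  have hUmem : ∀ q, ∀ d ∈ Uf q, ∃ d₀ ∈ U₀, Af q d₀ = d := fun q d hd => by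
    simpa only [hUf, mem_image] using hd
  have hU1 : ∀ q ∈ X \ P, ∀ d ∈ Uf q, ‖d‖ = 1 := by
    intro q _ d hd
    obtain ⟨d₀, hd₀, rfl⟩ := hUmem q d hd
    rw [LinearIsometryEquiv.norm_map]; exact (hU₀ d₀ hd₀).2
  have hUsep : ∀ q ∈ X \ P, ∀ d ∈ Uf q, ∀ d' ∈ Uf q, d ≠ d' → ⟪d, d'⟫_ℝ ≤ 1 / 2 := by
    intro q _ d hd d' hd' hne
    obtain ⟨d₀, hd₀, rfl⟩ := hUmem q d hd
    obtain ⟨d₀', hd₀', rfl⟩ := hUmem q d' hd'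
    rw [LinearIsometryEquiv.inner_map_map]
    exact real_inner_le_half_of_fcc_unit (hU₀ d₀ hd₀).1 (hU₀ d₀' hd₀').1 (hU₀ d₀ hd₀).2 (hU₀ d₀' hd₀').2
      (fun h => hne (by rw [h]))
  have hUneg : ∀ q ∈ X \ P, ∀ d ∈ Uf q, -d ∈ Uf q := by
    intro q _ d hd
    obtain ⟨d₀, hd₀, rfl⟩ := hUmem q d hd
    exact mem_image.2 ⟨-d₀, hU₀neg d₀ hd₀, by simp⟩
  have hUcard : ∀ q ∈ X \ P, (Uf q).card = 12 := by
    intro q _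
    simp only [hUf]
    rw [card_image_of_injective _ (Af q).injective, hU₀card]
  have hcapq : ∀ q ∈ X \ P, ∀ ν : EuclideanSpace ℝ (Fin 3), ‖ν‖ = 1 → ∀ t : ℝ, 0 < t →
      ∀ K : Finset (EuclideanSpace ℝ (Fin 3)), K.card ≤ 3 →
      (∀ u ∈ K, ‖u‖ = 1 ∧ ⟪u, ν⟫_ℝ ≤ -t) → (∀ u ∈ K, ∀ u' ∈ K, u ≠ u' → ⟪u, u'⟫_ℝ ≤ 1 / 2) →
      (K.card : ℝ) ≤
        (((Uf q).filter fun d => ⟪d, ν⟫_ℝ < 0 ∧ ((∃ u ∈ K, 1 / 2 < ⟪u, d⟫_ℝ) ∨ ⟪d, ν⟫_ℝ ≤ -t)).card : ℝ)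
          + (1 / 2) * (((Uf q).filter fun d => ⟪d, ν⟫_ℝ = 0 ∧ ∃ u ∈ K, 1 / 2 < ⟪u, d⟫_ℝ).card : ℝ) :=
    fun q _ => stub_frameCapBudget U₀ hU₀ hU₀neg hU₀card (Af q)
  have hbelow : ∀ p ∈ P, ⟪p, ν⟫_ℝ ≤ -(1 : ℝ) := fun p hp => ((hP p).1 hp).2.2.1
  have h3 : ∀ q ∈ X \ P, (P.filter fun p => dist q p = 1).card ≤ 3 := by
    intro q hq
    refine fcc_offLattice_unitContacts_le_three q (hoff q hq) _ fun y hy => ?_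
    exact ⟨((hP y).1 (mem_filter.1 hy).1).1, (mem_filter.1 hy).2⟩
  have hreg' : ∀ q ∈ X \ P, ∀ x ∈ X \ P, dist q x = 1 → x - q ∈ Uf q ∨
      ((∀ d ∈ Uf q, ⟪x - q, d⟫_ℝ ≤ Real.sqrt 3 / 2) ∧ ⟪q, ν⟫_ℝ < ⟪x, ν⟫_ℝ) := by
    intro q hq x hx hqx
    rcases hreg q hq x hx hqx with hmem | ⟨hint, habv⟩
    · left
      have hnorm : ‖(Af q).symm (x - q)‖ = 1 := by
        rw [LinearIsometryEquiv.norm_map, ← dist_eq_norm, dist_comm, hqx]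
      have h0 := fcc_unit_mem_of_bondStar U₀ hU₀ hU₀card hmem hnorm
      exact mem_image.2 ⟨(Af q).symm (x - q), h0, by simp⟩
    · right
      refine ⟨fun d hd => ?_, habv⟩
      obtain ⟨d₀, hd₀, rfl⟩ := hUmem q d hd
      have := hint d₀ hd₀
      rwa [← LinearIsometryEquiv.inner_map_map (Af q), LinearIsometryEquiv.apply_symm_apply] at this
  exact multiFrameFilm_cross_le X P hX hPX Uf hU1 hUsep hUneg hUcard hcapq ν hν 1 hbelow habove h3 hreg'

end Summit.Ventures.Crystal3D.Theorems

end
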